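import Summits.CriticalPhenomena.PercolationContinuityZ3.Theorems.PercNearOneGluingNoHeavyLowerTailSahiOneStepProfileGrid
import HarnessLib

/-!
# The profile-grid theorem for an up-set of the grid (CONJECTURE `G_d` for OR-of-threshold partners)

Prover prim-ineq-prove-3 gen 44 (`--supports stmt-CriticalPhenomena-4575`).  Corollary file of `…SahiOneStepProfileGrid` (no definitions, no sorries).
`ProfileGrid.grid_osN_nonneg` takes a numerator `u` with one-coordinate cross inequalities; for `u = 1_A · Φ` with `A` an UP-SET of the grid these are
automatic, giving the clean statement: on every finite product of `PF₂` chains `Π_j {0,…,N}` (independent log-concave coordinates, e.g. Poisson,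
binomial, Poisson-binomial block counts), for the Hamming slot `H = {Σ_j v_j ≥ t}`, EVERY up-set `A` and every OR of coordinate thresholds
`B = {∃ j, v_j ≥ r_j}`, the one-step functional `n(1_A, 1_B) = ℓ·Φ(A∩B∩H) + Φ(A∩L)Φ(B∩L) − ℓ·Φ(A)Φ(B)` is `≥ 0` (five-term shape of `osN_ind_ind`).
This is the `B = OR of coordinate thresholds` case of the log-concave-chain conjecture `G_d` of the programme (memo
`run/shared/lean/prim/prim-ineq-prove-3/FINDING-G41-2D-SHRINK.md`), for every `d` and every `PF₂` weights.
-/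

noncomputable section

namespace Summit.CriticalPhenomena.PercolationContinuityZ3.Theorems

namespace SahiOneStep

namespace ProfileGrid

open Finset Function
open Literature.Probability.Distributions (IsLogConcaveSeq piWeight blockSum)
open scoped Classical

variable {κ : Type*} [Fintype κ] [DecidableEq κ] {N : ℕ}

/-- **`(2′)` ON A PRODUCT OF `PF₂` CHAINS for an up-set against an OR of coordinate thresholds.** [this work] -/
theorem grid_osN_nonneg_of_isUpperSet (φ : κ → ℕ → ℝ) (hφ : ∀ j, IsLogConcaveSeq (φ j)) (hφ1 : ∀ j, ∑ n : Fin (N + 1), φ j n = 1)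
    (r : κ → ℕ) (t : ℕ) {A : Set (κ → Fin (N + 1))} (hA : IsUpperSet A) :
    0 ≤ (∑ v : κ → Fin (N + 1), if t ≤ blockSum univ v then (if v ∈ A then piWeight N φ v else 0) else 0) *
          (∑ v : κ → Fin (N + 1), if t ≤ blockSum univ v ∧ (∃ j, r j ≤ (v j : ℕ)) then piWeight N φ v else 0)
      + (1 - ∑ v : κ → Fin (N + 1), if t ≤ blockSum univ v then piWeight N φ v else 0) *
          (∑ v : κ → Fin (N + 1), if t ≤ blockSum univ v ∧ (∃ j, r j ≤ (v j : ℕ)) then (if v ∈ A then piWeight N φ v else 0) else 0)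
      + (∑ v : κ → Fin (N + 1), if t ≤ blockSum univ v then piWeight N φ v else 0) *
          (∑ v : κ → Fin (N + 1), if v ∈ A then piWeight N φ v else 0) *
          (∑ v : κ → Fin (N + 1), if (∃ j, r j ≤ (v j : ℕ)) then piWeight N φ v else 0)
      - (∑ v : κ → Fin (N + 1), if t ≤ blockSum univ v then (if v ∈ A then piWeight N φ v else 0) else 0) *
          (∑ v : κ → Fin (N + 1), if (∃ j, r j ≤ (v j : ℕ)) then piWeight N φ v else 0)
      - (∑ v : κ → Fin (N + 1), if t ≤ blockSum univ v ∧ (∃ j, r j ≤ (v j : ℕ)) then piWeight N φ v else 0) *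
          (∑ v : κ → Fin (N + 1), if v ∈ A then piWeight N φ v else 0) := by
  have hφ0 : ∀ j n, 0 ≤ φ j n := fun j => (hφ j).1
  refine grid_osN_nonneg φ hφ hφ1 r t (fun v => if v ∈ A then piWeight N φ v else 0)
    (fun v => by split_ifs <;> [exact piWeight_nonneg hφ0 v; exact le_rfl])
    (fun v => by split_ifs <;> [exact le_rfl; exact piWeight_nonneg hφ0 v]) (fun v j x x' hxx' => ?_)
  -- the one-coordinate cross inequality for `1_A · Φ`
  by_cases hx : update v j x ∈ A
  · have hx' : update v j x' ∈ A := hA (fun i => by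
      by_cases hi : i = j
      · subst hi; rw [update_self, update_self]; exact hxx'
      · rw [update_of_ne hi, update_of_ne hi]) hx
    rw [if_pos hx, if_pos hx', piWeight_update, piWeight_update]
    apply le_of_eq; ring
  · rw [if_neg hx, zero_mul]
    exact mul_nonneg (by split_ifs <;> [exact piWeight_nonneg hφ0 _; exact le_rfl]) (hφ0 j _)

end ProfileGrid

end SahiOneStep

end Summit.CriticalPhenomena.PercolationContinuityZ3.Theorems
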